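import Summits.QuantumFields.QCD.Theorems.LightQuarkCompletion.Negative.Anatomy

/-!
# Crux `LightQuarkCompletion` (stmt-QuantumFields-18066, route NestedDissectionSea, rank 6), negative side —
# the flavour restriction `N_f ∈ {2,3}` is load-bearing: at `N_f = 0` the conclusion is INCONSISTENT

Support file of the standing disprover (cycle 2, refuter-cdisprove-stmt-QuantumFields-18066-g2-0, 2026-08-17; extract of
`Cruxes/LightQuarkCompletion/Disproof.lean` §12).  NO refutation of the crux (which is guarded by `Nf = 2 ∨ Nf = 3`).  Sorry-free,
standard axioms; the `def`s are statement abbreviations (the crux / stub J with the flavour guard deleted, and two hypothesis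
classes `H`); nothing asserts a Theses decl.

At `N_f = 0` there is exactly ONE mass tuple (`Fin 0 → ℝ` is a subsingleton).  The `QCDOf` body at every (i.e. at the) tuple gives
a lattice gap rate `Δ > 0` there, while `IsChiralAtZero` asks, for `ε := Δ`, a tuple WITHOUT the gap `Δ` — the same tuple.  Hence
`Body 0 reg M₀ → ¬ reg.IsChiralAtZero` (`not_isChiralAtZero_of_body_zeroFlavour`) and `¬ Concl 0` (`not_concl_zero`) OUTRIGHT:
the conclusion shape of the crux is inconsistent in the quenched theory.  Consequently

* `lightQuarkCompletionAllFlavours_false_of` — the crux with `Nf = 2 ∨ Nf = 3` deleted is FALSE as soon as the quenched threshold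
  package is inhabited (`QuenchedThresholdPackage`: a two-sided-pinned SU(3) lattice Yang–Mills regularisation with OS limit,
  non-trivial non-Gaussian glue and a gap — believed TRUE, not constructible here);
* `stubJumpLineIsChiralAllFlavours_false_of` — stub J with the flavour guard deleted is FALSE as soon as the zero-threshold-pinned
  quenched package is inhabited (`ZeroPinnedQuenchedPackage`, believed TRUE).

So any proof of J (and of the crux) must USE `N_f ≥ 2` — in Lean, not only in physics (where `N_f = 1` is the sharper reason:
no Goldstone boson; at `N_f = 1` the tuples no longer coincide and nothing is provable here).  The flavour input of card
`anomaly-at-the-pinned-corner` is therefore not optional.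
-/

noncomputable section

open scoped BigOperators Classical
open MeasureTheory Filter Topology Matrix
open Literature.MathematicalPhysics.QuantumLattice Literature.MathematicalPhysics.QuantumFieldTheory
  Literature.Probability.LatticeModels
open Summit.QuantumFields.QCD.Theses.NestedDissectionSea
open Summit.QuantumFields.QCD.Theorems.CoerciveSeaNegative
open Summit.QuantumFields.QCD.Theorems.EarlyCrosserLawNegative

namespace Summit.QuantumFields.QCD.Theorems.LightQuarkCompletion.Negative

/-- At `N_f = 0` all mass tuples coincide. [folklore] -/
theorem tuple_eq_of_zeroFlavour (m m' : Fin 0 → ℝ) : m = m' :=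
  funext fun f => f.elim0

/-- **At `N_f = 0` the body excludes chirality at zero**: the body gives a gap `Δ > 0` at the unique tuple, `IsChiralAtZero`
asks a tuple without the gap `Δ`. [folklore] -/
theorem not_isChiralAtZero_of_body_zeroFlavour {reg : QCDRegularisation 0} {M₀ : ℝ} (h : Body 0 reg M₀) :
    ¬ reg.IsChiralAtZero := by
  intro hχ
  obtain ⟨z, shift, T, -, -, -, -, Δ, hΔ, -, hgap⟩ := h (fun f => f.elim0) (fun f => f.elim0)
  obtain ⟨m, -, hno⟩ := hχ Δ hΔ
  apply hno
  rw [tuple_eq_of_zeroFlavour m (fun f => f.elim0)]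
  -- the lattice gap clause never reads `(z, shift)` (cf. `RobustYangMillsHandover.Negative.hasLatticeMassGap_scheme_indep`)
  exact hgap

/-- **`¬ Concl 0`**: the conclusion shape of the crux is inconsistent in the quenched theory. [folklore] -/
theorem not_concl_zero : ¬ Concl 0 := by
  rintro ⟨reg', -, -, -, -, hχ, hbody⟩
  exact not_isChiralAtZero_of_body_zeroFlavour hbody hχ

/-- **The crux with the flavour guard `Nf = 2 ∨ Nf = 3` DELETED.**  Statement abbreviation; FALSE modulo
`QuenchedThresholdPackage`. -/
def LightQuarkCompletionAllFlavours : Prop :=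
  ∀ (Nf : ℕ) (reg : QCDRegularisation Nf) (M₀ : ℝ), HypAt Nf reg M₀ → Concl Nf

/-- **H₀ — the quenched threshold package is inhabited**: some `N_f = 0` regularisation (SU(3) lattice Yang–Mills along an
asymptotically scaling sequence) carries mass scaling, the weak branch, a threshold, the two-sided parity pin of the QUENCHED
Wilson determinant sign above it, and the body (OS limit of the glue species, non-trivial, non-Gaussian, gapped, uniform lattice
gap).  Believed TRUE (pinned gapped Yang–Mills); not constructible in the tree. [topic constructive-qft] -/
def QuenchedThresholdPackage : Prop :=
  ∃ (reg : QCDRegularisation 0) (M₀ : ℝ), HypAt 0 reg M₀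

/-- **The flavour guard is load-bearing in the crux (modulo H₀).** [folklore] -/
theorem lightQuarkCompletionAllFlavours_false_of (H : QuenchedThresholdPackage) : ¬ LightQuarkCompletionAllFlavours := by
  intro h
  obtain ⟨reg, M₀, hH⟩ := H
  exact not_concl_zero (h 0 reg M₀ hH)

/-- **Stub J with the flavour guard DELETED** (over the abbreviations).  Statement abbreviation; FALSE modulo
`ZeroPinnedQuenchedPackage`. -/
def StubJumpLineIsChiralAllFlavours : Prop :=
  ∀ (Nf : ℕ) (reg' : QCDRegularisation Nf), reg'.HasMassScaling → (reg'.scheme 0 0 0).HasAsymptoticScaling →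
    Tendsto reg'.mcrit atTop (𝓝 0) → PinPkg Nf reg' 0 → Body Nf reg' 0 → reg'.IsChiralAtZero

/-- **H₀′ — the zero-threshold-pinned quenched package is inhabited**: an `N_f = 0` regularisation with both scalings,
`m_crit → 0`, the two-sided pin of the quenched determinant sign at zero threshold and the body.  Believed TRUE; not constructible
here. [topic constructive-qft] -/
def ZeroPinnedQuenchedPackage : Prop :=
  ∃ reg' : QCDRegularisation 0, reg'.HasMassScaling ∧ (reg'.scheme 0 0 0).HasAsymptoticScaling ∧
    Tendsto reg'.mcrit atTop (𝓝 0) ∧ PinPkg 0 reg' 0 ∧ Body 0 reg' 0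

/-- **The flavour guard is load-bearing in stub J (modulo H₀′)**: with it deleted, J would make the pinned quenched
regularisation chiral at zero, which its own body forbids. [folklore] -/
theorem stubJumpLineIsChiralAllFlavours_false_of (H : ZeroPinnedQuenchedPackage) : ¬ StubJumpLineIsChiralAllFlavours := by
  intro h
  obtain ⟨reg', hMS, hAS, hlim, hpin, hbody⟩ := H
  exact not_isChiralAtZero_of_body_zeroFlavour hbody (h 0 reg' hMS hAS hlim hpin hbody)

end Summit.QuantumFields.QCD.Theorems.LightQuarkCompletion.Negative

end
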